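import Summits.QuantumFields.BalabanUV.Beta.GAN24.Push4NestAux
import Summits.QuantumFields.BalabanUV.Beta.GAN24.Push4NestTable

/-!
# `BalabanUV.Beta.GAN24.Push4Sym` — binder row G-an2-4 / (CONV-C), W-slot road «W3» (SKELETON-W3 v1.0 §8.3 (F1) / §8.6; (R12-5) `T2LinearPartEq` in
# import-free form): THE SYMMETRISED LINEAR PART IS A SYMMETRISED PUSH — swap law, linearity, and
# `mmRead N (K ∘ ½(vertex2OfK K N X μyνy′ + vertex2OfK K N X νy′μy) ∘ K) = ½(push₄ (rowM K N) (colH K N) X μyνy′ + push₄ (rowM K N) (colH K N) X νy′μy)`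

NOT IN PRINT; OUR PROOF ATTEMPT (G-an2-4 formalisation swarm, leaf prover `b2b-balaban-gan24-formalise-leaf-17`, gen 14; names PROVISIONAL — the row owner
gan24-p1 may rename / re-cut).  HONEST FRAMING (cell contract, verbatim): «discharging `BetaPertH` makes Bałaban's UV stability UNCONDITIONAL — a real
constructive-QFT result; it is NOT the continuum limit and NOT the Clay problem.»  HONEST DEPENDENCY (verbatim): «continuum YM on T⁴ ⇐ BetaPertH ∧ nine
spine estimates (0/9 proved); BetaPertH ⇐ (D1) ∧ (D4) ∧ CAP+tail; G-an2-4 gates asym, D1 and NE2/3/4.»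

WHAT.  The linear part of the normalised `T2Of` recursion adopted by the row owner is leaf-04's `T2RecursionAffine.lin4 c K N X μ y ν y′ =
−(c • mmRead N (K ∘ vsym K N X μ y ν y′ ∘ K))` with `vsym K N X μ y ν y′ = ½ • (vertex2OfK K N X μ y ν y′ + vertex2OfK K N X ν y′ μ y)` (p210349).  This module
proves, for EVERY decaying packed `K` and every `LocStencil₂` table with ff-valued entries, with `vsym` written OUT (so that `lin4_apply` rewrites into it by `rfl`):
* §1 LINEARITY under summability: `comp_left_lin` / `comp_right_lin` (a `comp` with summable rows / columns is linear on BOUNDED kernels), `ffRead_lin`, `mmRead_lin`,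
  `isFF_lin`;
* §2 THE SWAP LAW: **`vertex2W_swap`** / **`push₄_swap`** — pushing the table with its two bond arguments exchanged is the push read with its two OUTPUT bonds
  exchanged (`Push4NestTable.vertexW_comm`, one dominated Fubini);
* §3 **`mmRead_sandwich_vsym_eq_push₄`**: `Decays K CK m → 0 < m → (∀ κ u κ′ u′, IsFF (X κ u κ′ u′)) → LocStencil₂ X C δ → 0 < δ →
  mmRead N (comp (comp K ((1/2:ℝ) • (vertex2OfK K N X μ y ν y′ + vertex2OfK K N X ν y′ μ y))) K)
    = (1/2:ℝ) • (push₄ (rowM K N) (colH K N) X μ y ν y′ + push₄ (rowM K N) (colH K N) X ν y′ μ y)`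
  — i.e. `lin4 c K N X μ y ν y′ = −(c • ½(push₄ … μ y ν y′ + push₄ … ν y′ μ y))`: THE 𝒜_j OF RECORD IS A SYMMETRISED FOUR-LEG PUSH (and, by §2, for tables symmetric
  under the bond swap, a plain push).
[folklore]; 0 cited facts, 0 `Prop` mirrors, 0 definitions, 0 sorry.  Asserts NO shape of Bałaban's tables; «T2Shape» / «T2SupRate» LOCATED / OPEN, NOT IN PRINT;
discharges NOTHING of (hW, hWall); 0 wall binders instantiated; NOT «W-slot closed», NEVER «G-an2-4 closed»; NOT BetaPertH, NOT continuum, NOT Clay.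
-/

noncomputable section

open Finset
open scoped BigOperators
open Literature.MathematicalPhysics.QuantumFieldTheory
open Literature.MathematicalPhysics.QuantumFieldTheory.Balaban1983to89
open Literature.MathematicalPhysics.QuantumFieldTheory.Balaban1983to89.Beta
open B12Sec2to5 (l1 l1_nonneg)
open ExpKernelCalculus (MKer Decays BiLoc comp Zl Zl_nonneg summable_exp_shift)
open OneStepResolventKernel (Fib wsum LocStencil)
open OneStepKernelFamily (colH)
open KKTFluctuationEnergy (summable_mul_of_bdd summable_mul_of_bdd')
open BalabanCompositeJets (LocStencil₂)
open SecondOrderResponse (vertex2OfK)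
open Summit.QuantumFields.BalabanUV.Beta.GAN24.Push4 (rowM legComp vertexW vertexW_apply vertex2W vertex2OfK_eq_vertex2W Lk Rk ffRead push₄ IsFF
  Lk_inl_inl Lk_inl_inr Lk_inr Rk_inl_inl Rk_inr_left Rk_inr_right ffRead_inl_inl ffRead_inr_left ffRead_inr_right push₄_def isFF_vertex2OfK
  mmRead_sandwich_eq)
open BalabanStepJetsSucc (mmRead mmRead_inl_inl mmRead_inr_left mmRead_inr_right)
open Summit.QuantumFields.BalabanUV.Beta.GAN24.Push4Bounds (LegDecay LegDecay.nonneg LegDecay.abs_le LegDecay.summable legDecay_colH legDecay_rowM)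
open Summit.QuantumFields.BalabanUV.Beta.GAN24.Push4NestTable (vertexW_comm)
open Summit.QuantumFields.BalabanUV.Beta.GAN24.Push4NestAux (decays_vertex2W_of_bdd abs_le_of_decays abs_comp_Lk_le_of_decays summable_Lk_row summable_Rk_col)

namespace Summit.QuantumFields.BalabanUV.Beta.GAN24.Push4Sym

variable {d : ℕ}
variable {l r : Fin (d + 1) → (Fin (d + 1) → ℤ) → Fin (d + 1) → (Fin (d + 1) → ℤ) → ℝ} {N : ℕ} {C Cr Cl m δ : ℝ}
  {X : Fin (d + 1) → (Fin (d + 1) → ℤ) → Fin (d + 1) → (Fin (d + 1) → ℤ) → MKer (d + 1) (Fib d)}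

/-! ## §1 Linearity under summability -/

/-- [folklore] A composition whose LEFT factor has summable rows is linear on bounded right factors:
`comp A (s • (V₁ + V₂)) = s • (comp A V₁ + comp A V₂)`. -/
theorem comp_left_lin {A V₁ V₂ : MKer (d + 1) (Fib d)} {C₁ C₂ : ℝ} (hA : ∀ x a f, Summable fun w => A x w a f)
    (h₁ : ∀ w z f b, |V₁ w z f b| ≤ C₁) (h₂ : ∀ w z f b, |V₂ w z f b| ≤ C₂) (s : ℝ) :
    comp A (s • (V₁ + V₂)) = s • (comp A V₁ + comp A V₂) := by
  funext x z a b
  simp only [comp, Pi.smul_apply, Pi.add_apply, smul_eq_mul]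
  have hs₁ : Summable fun w => ∑ f, A x w a f * V₁ w z f b :=
    summable_sum fun f _ => summable_mul_of_bdd' (hA x a f) (fun w => h₁ w z f b)
  have hs₂ : Summable fun w => ∑ f, A x w a f * V₂ w z f b :=
    summable_sum fun f _ => summable_mul_of_bdd' (hA x a f) (fun w => h₂ w z f b)
  calc (∑' w, ∑ f, A x w a f * (s * (V₁ w z f b + V₂ w z f b)))
      = ∑' w, s * ((∑ f, A x w a f * V₁ w z f b) + ∑ f, A x w a f * V₂ w z f b) := tsum_congr fun w => by
        rw [← Finset.sum_add_distrib, Finset.mul_sum]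
        exact Finset.sum_congr rfl fun f _ => by ring
    _ = s * ((∑' w, ∑ f, A x w a f * V₁ w z f b) + ∑' w, ∑ f, A x w a f * V₂ w z f b) := by
        rw [tsum_mul_left, hs₁.tsum_add hs₂]

/-- [folklore] A composition whose RIGHT factor has summable columns is linear on bounded left factors:
`comp (s • (M₁ + M₂)) B = s • (comp M₁ B + comp M₂ B)`. -/
theorem comp_right_lin {B M₁ M₂ : MKer (d + 1) (Fib d)} {C₁ C₂ : ℝ} (hB : ∀ z f b, Summable fun w => B w z f b)
    (h₁ : ∀ x w a f, |M₁ x w a f| ≤ C₁) (h₂ : ∀ x w a f, |M₂ x w a f| ≤ C₂) (s : ℝ) :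
    comp (s • (M₁ + M₂)) B = s • (comp M₁ B + comp M₂ B) := by
  funext x z a b
  simp only [comp, Pi.smul_apply, Pi.add_apply, smul_eq_mul]
  have hs₁ : Summable fun w => ∑ f, M₁ x w a f * B w z f b :=
    summable_sum fun f _ => summable_mul_of_bdd (fun w => h₁ x w a f) (hB z f b)
  have hs₂ : Summable fun w => ∑ f, M₂ x w a f * B w z f b :=
    summable_sum fun f _ => summable_mul_of_bdd (fun w => h₂ x w a f) (hB z f b)
  calc (∑' w, ∑ f, s * (M₁ x w a f + M₂ x w a f) * B w z f b)
      = ∑' w, s * ((∑ f, M₁ x w a f * B w z f b) + ∑ f, M₂ x w a f * B w z f b) := tsum_congr fun w => by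
        rw [← Finset.sum_add_distrib, Finset.mul_sum]
        exact Finset.sum_congr rfl fun f _ => by ring
    _ = s * ((∑' w, ∑ f, M₁ x w a f * B w z f b) + ∑' w, ∑ f, M₂ x w a f * B w z f b) := by
        rw [tsum_mul_left, hs₁.tsum_add hs₂]

/-- [folklore] The ff-corner read is linear (pointwise). -/
theorem ffRead_lin (W₁ W₂ : MKer (d + 1) (Fib d)) (s : ℝ) : ffRead (s • (W₁ + W₂)) = s • (ffRead W₁ + ffRead W₂) := by
  funext x z a b
  rcases a with α | μ
  · rcases b with β | ν
    · simp only [ffRead_inl_inl, Pi.smul_apply, Pi.add_apply]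
    · simp only [ffRead_inr_right, Pi.smul_apply, Pi.add_apply, smul_eq_mul, add_zero, mul_zero]
  · simp only [ffRead_inr_left, Pi.smul_apply, Pi.add_apply, smul_eq_mul, add_zero, mul_zero]

/-- [folklore] ff-valued kernels are closed under the linear operations. -/
theorem isFF_lin {V₁ V₂ : MKer (d + 1) (Fib d)} (h₁ : IsFF V₁) (h₂ : IsFF V₂) (s : ℝ) : IsFF (s • (V₁ + V₂)) := by
  refine ⟨fun x z μ b => ?_, fun x z a ν => ?_⟩
  · simp only [Pi.smul_apply, Pi.add_apply, smul_eq_mul, h₁.1, h₂.1, add_zero, mul_zero]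
  · simp only [Pi.smul_apply, Pi.add_apply, smul_eq_mul, h₁.2, h₂.2, add_zero, mul_zero]

/-! ## §2 The swap law: exchanging the table's bond arguments exchanges the push's output bonds -/

/-- [folklore] **SWAP LAW FOR THE SECOND-ORDER VERTEX**: for legs localised at a positive rate and a `LocStencil₂` table at a positive rate,
`vertex2W r (fun κ u κ′ u′ ↦ X κ′ u′ κ u) ν y′ μ y = vertex2W r X μ y ν y′` (one dominated Fubini, `Push4NestTable.vertexW_comm`). -/
theorem vertex2W_swap (hr : LegDecay r N Cr m) (hm : 0 < m) (hX : LocStencil₂ X C δ) (hδ : 0 < δ) (μ : Fin (d + 1)) (y : Fin (d + 1) → ℤ)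
    (ν : Fin (d + 1)) (y' : Fin (d + 1) → ℤ) :
    vertex2W r (fun κ u κ' u' => X κ' u' κ u) ν y' μ y = vertex2W r X μ y ν y' := by
  have hC := hX.nonneg
  have hG : ∀ κ x z a b, ∃ g : (Fin (d + 1) → ℤ) → ℝ, Summable g ∧ ∀ u l' v', |X κ u l' v' x z a b| ≤ g u := by
    intro κ x z a b
    refine ⟨fun u => C * Real.exp (-δ * (l1 (x - u) + l1 (z - u))), ?_, fun u l' v' => ?_⟩
    · refine Summable.of_nonneg_of_le (fun u => by positivity) (fun u => ?_) ((summable_exp_shift hδ x).mul_left C)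
      refine mul_le_mul_of_nonneg_left (Real.exp_le_exp.2 ?_) hC
      nlinarith [l1_nonneg (z - u), l1_nonneg (x - u)]
    · refine (hX κ u l' v' x z a b).trans ?_
      have h1 : Real.exp (-δ * l1 (v' - u)) ≤ 1 := by rw [Real.exp_le_one_iff]; nlinarith [l1_nonneg (v' - u)]
      have h2 : 0 ≤ Real.exp (-δ * (l1 (x - u) + l1 (z - u))) := (Real.exp_pos _).le
      nlinarith [mul_le_mul_of_nonneg_right h1 (mul_nonneg hC h2)]
  exact vertexW_comm (r₁ := r) (r₂ := r) (G := fun κ u l' v' => X κ u l' v') (fun l' => hr.summable hm ν y' l')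
    (fun κ u => hr.abs_le hm.le μ y κ u) hG

/-- [folklore] **SWAP LAW FOR THE PUSH**: `push₄ l r (fun κ u κ′ u′ ↦ X κ′ u′ κ u) ν y′ μ y = push₄ l r X μ y ν y′` — the push of the bond-swapped table is
the push read with its output bonds swapped (the left kernel leg family `l` is arbitrary). -/
theorem push₄_swap (hr : LegDecay r N Cr m) (hm : 0 < m) (hX : LocStencil₂ X C δ) (hδ : 0 < δ) (μ : Fin (d + 1)) (y : Fin (d + 1) → ℤ)
    (ν : Fin (d + 1)) (y' : Fin (d + 1) → ℤ) :
    push₄ l r (fun κ u κ' u' => X κ' u' κ u) ν y' μ y = push₄ l r X μ y ν y' := by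
  rw [push₄_def, push₄_def, vertex2W_swap hr hm hX hδ μ y ν y']

/-! ## §3 The symmetrised linear part of the recursion is the symmetrised push -/

/-- [folklore] **`T2LinearPartEq` (import-free form): THE SYMMETRISED SANDWICH READ IS THE SYMMETRISED FOUR-LEG PUSH.**  For every packed kernel decaying at a
positive rate and every `LocStencil₂` table with ff-valued entries,
`mmRead N (K ∘ ½•(vertex2OfK K N X μ y ν y′ + vertex2OfK K N X ν y′ μ y) ∘ K) = ½•(push₄ (rowM K N) (colH K N) X μ y ν y′ + push₄ (rowM K N) (colH K N) X ν y′ μ y)`.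
With leaf-04's `T2RecursionAffine.lin4_apply` / `vsym` (by `rfl`) this reads `lin4 c K N X μ y ν y′ = −(c • ½•(push₄ … μ y ν y′ + push₄ … ν y′ μ y))`: the
`𝒜_j` of record (SKELETON-W3 v1.0, `WSlotT2OfPieces`) is a symmetrised four-leg push. -/
theorem mmRead_sandwich_vsym_eq_push₄ {K : MKer (d + 1) (Fib d)} {CK : ℝ} (hK : Decays K CK m) (hm : 0 < m)
    (hX : ∀ κ u κ' u', IsFF (X κ u κ' u')) (hXl : LocStencil₂ X C δ) (hδ : 0 < δ)
    (μ : Fin (d + 1)) (y : Fin (d + 1) → ℤ) (ν : Fin (d + 1)) (y' : Fin (d + 1) → ℤ) :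
    mmRead N (comp (comp K ((1 / 2 : ℝ) • (vertex2OfK K N X μ y ν y' + vertex2OfK K N X ν y' μ y))) K)
      = (1 / 2 : ℝ) • (push₄ (rowM K N) (colH K N) X μ y ν y' + push₄ (rowM K N) (colH K N) X ν y' μ y) := by
  have hCK : 0 ≤ CK := hK.nonneg (Sum.inl 0)
  have hl : LegDecay (rowM K N) N CK m := legDecay_rowM hK
  have hr : LegDecay (colH K N) N CK m := legDecay_colH hK
  have hlb : ∀ α x' κ x, |rowM K N α x' κ x| ≤ CK := fun α x' κ x => hl.abs_le hm.le α x' κ x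
  have hrb : ∀ μ₀ y₀ κ u, |colH K N μ₀ y₀ κ u| ≤ CK := fun μ₀ y₀ κ u => hr.abs_le hm.le μ₀ y₀ κ u
  have hls : ∀ α x' κ, Summable fun x => rowM K N α x' κ x := fun α x' κ => hl.summable hm α x' κ
  have hrs : ∀ β z' κ, Summable fun z => colH K N β z' κ z := fun β z' κ => hr.summable hm β z' κ
  -- the two vertices are ff-valued, bounded, and `vertex2W` of the column family
  set V₁ := vertex2OfK K N X μ y ν y' with hV₁
  set V₂ := vertex2OfK K N X ν y' μ y with hV₂
  have hff : IsFF ((1 / 2 : ℝ) • (V₁ + V₂)) := isFF_lin (isFF_vertex2OfK K N hX μ y ν y') (isFF_vertex2OfK K N hX ν y' μ y) _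
  have hdec₁ : Decays V₁ ((d + 1 : ℕ) * (CK * ((d + 1 : ℕ) * (CK * (C * Zl (d + 1) δ))) * Zl (d + 1) (δ / 2))) (δ / 2) := by
    have h := decays_vertex2W_of_bdd hrb hCK hXl hδ μ y ν y'
    rw [← vertex2OfK_eq_vertex2W] at h
    exact h
  have hdec₂ : Decays V₂ ((d + 1 : ℕ) * (CK * ((d + 1 : ℕ) * (CK * (C * Zl (d + 1) δ))) * Zl (d + 1) (δ / 2))) (δ / 2) := by
    have h := decays_vertex2W_of_bdd hrb hCK hXl hδ ν y' μ y
    rw [← vertex2OfK_eq_vertex2W] at h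
    exact h
  have hb₁ := fun w z f b => abs_le_of_decays hdec₁ (half_pos hδ).le w z f b
  have hb₂ := fun w z f b => abs_le_of_decays hdec₂ (half_pos hδ).le w z f b
  -- read, then distribute the sandwich over the two vertices
  rw [mmRead_sandwich_eq K N hff, comp_left_lin (fun x a f => summable_Lk_row hls x a f) hb₁ hb₂,
    comp_right_lin (fun z f b => summable_Rk_col hrs z f b)
      (fun x w a f => abs_comp_Lk_le_of_decays hlb hCK hdec₁ (half_pos hδ) x w a f)
      (fun x w a f => abs_comp_Lk_le_of_decays hlb hCK hdec₂ (half_pos hδ) x w a f),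
    ffRead_lin]
  simp only [hV₁, hV₂, push₄_def, vertex2OfK_eq_vertex2W]

/-- [folklore] **FOR BOND-SYMMETRIC TABLES THE SYMMETRISATION IS INVISIBLE**: if `X κ u κ′ u′ = X κ′ u′ κ u` then the symmetrised read is the plain push
`push₄ (rowM K N) (colH K N) X μ y ν y′` (§2's swap law). -/
theorem mmRead_sandwich_vsym_eq_push₄_of_symm {K : MKer (d + 1) (Fib d)} {CK : ℝ} (hK : Decays K CK m) (hm : 0 < m)
    (hX : ∀ κ u κ' u', IsFF (X κ u κ' u')) (hXl : LocStencil₂ X C δ) (hδ : 0 < δ) (hXs : ∀ κ u κ' u', X κ' u' κ u = X κ u κ' u')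
    (μ : Fin (d + 1)) (y : Fin (d + 1) → ℤ) (ν : Fin (d + 1)) (y' : Fin (d + 1) → ℤ) :
    mmRead N (comp (comp K ((1 / 2 : ℝ) • (vertex2OfK K N X μ y ν y' + vertex2OfK K N X ν y' μ y))) K)
      = push₄ (rowM K N) (colH K N) X μ y ν y' := by
  rw [mmRead_sandwich_vsym_eq_push₄ hK hm hX hXl hδ]
  have hswap := push₄_swap (l := rowM K N) (legDecay_colH (N := N) hK) hm hXl hδ μ y ν y'
  have e : (fun κ u κ' u' => X κ' u' κ u) = X := funext fun κ => funext fun u => funext fun κ' => funext fun u' => hXs κ u κ' u'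
  rw [e] at hswap
  rw [hswap]
  funext x z a b
  simp only [Pi.smul_apply, Pi.add_apply, smul_eq_mul]
  ring

end Summit.QuantumFields.BalabanUV.Beta.GAN24.Push4Sym

end
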